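import Mathlib.Algebra.DirectSum.Module
import Mathlib.RepresentationTheory.Irreducible
import Mathlib.LinearAlgebra.Dimension.FreeAndStrongRankCondition
import Literature.NumberTheory.Automorphic.RestrictedTensorProductIrreducibleProofs
import HarnessLib

/-!
# Multiplicity at most one of an irreducible in a direct sum of pairwise non-isomorphic irreducible admissible
# representations (Schur's lemma for admissible representations, Hom-space form)

Topic `RepresentationTheory`; theorems only (no definition, no named fact).

Let `G` be a topological group possessing a compact open subgroup, `k` an algebraically closed field, and let
`τ : G → GL(H)` be a representation which is `G`-equivariantly isomorphic to a direct sum `⨁ i, W i` of representations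
`σ i` that are **irreducible or zero**, **admissible** (the tree's `Representation.IsAdmissible`: smooth with
finite-dimensional fixed vectors under every compact open subgroup) and **pairwise non-isomorphic** (no two distinct
non-zero summands are equivalent).  Then for every irreducible representation `ρ` of `G` the multiplicity space
`Hom_G(ρ, τ)` — Mathlib's bundled intertwining maps `Representation.IntertwiningMap ρ τ` — has `k`-rank `≤ 1`
(`rank_intertwiningMap_le_one_of_equivariant_directSum`; every intertwiner is a multiple of a non-zero one,
`exists_eq_smul_of_ne_zero`; rank exactly `1` out of a non-zero summand, `rank_intertwiningMap_eq_one_of_equivariant_directSum`).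
Seat prover-pub-hodgecm-own-htheta-g9-0 (Hodge-CM cell, Δ2 BRIDGE question Q2), 2026-08-23.

This is the Hom-space («module») form of the elementary multiplicity count behind [Liu2021, Prop. 4.13, proof l. 2145]
(«the dimension of `H¹_{B,τ'}(A_∞, ℂ)[ω(μ,ε,χ)]` is `1`»), consumed by `Literature/NumberTheory/Automorphic/Liu2021/`
`Prop413MultLeOneOfAsPrinted.lean`; it is recorded here in representation-theoretic generality.

## The argument (Bump 1997, Prop. 4.2.4 = Schur's lemma for irreducible admissible representations, and its standard
## corollaries; Bernstein–Zelevinsky 1976, 2.11)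

* An intertwiner between irreducible representations is zero or bijective (Mathlib
  `Representation.IsIrreducible.injective_or_eq_zero` / `bijective_or_eq_zero`).
* Hence the `i`-th component `π_i ∘ Φ ∘ f` of an intertwiner `f : ρ → τ ≅ ⨁ W i` is zero or an isomorphism `ρ ≅ σ i`;
  by pairwise non-isomorphy at most ONE index `i₀` carries a non-zero component, the same index for all intertwiners.
* Two intertwiners `f, g` with `g ≠ 0` therefore both factor through `W i₀`, and `π_{i₀} Φ f ∘ (π_{i₀} Φ g)⁻¹` is a
  `G`-endomorphism of the irreducible admissible `σ i₀`, hence a scalar `c` by Schur's lemma for admissible representations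
  (tree theorem `Representation.IsAdmissible.exists_eq_smul_id`, [Bump1997, Prop. 4.2.4]); so `f = c • g`.

## References
* [Bump1997] D. Bump, *Automorphic Forms and Representations*, CUP 1997 — Prop. 4.2.4 (Schur's lemma for irreducible
  admissible representations of a totally disconnected locally compact group) and the surrounding §4.2.
* [BernsteinZelevinsky1976] I. N. Bernstein, A. V. Zelevinsky, Russian Math. Surveys 31:3 (1976) 1–68 — 2.11.
* [Liu2021] Y. Liu, Camb. J. Math. 9 (2021) — Prop. 4.13 and its proof, l. 2145 (the consumer).
-/

noncomputable section

open scoped DirectSum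

namespace Literature.RepresentationTheory

namespace AdmissibleDirectSum

universe uk uG uV uH uι uW

variable {k : Type uk} [Field k] {G : Type uG} [Group G]
variable {V : Type uV} [AddCommGroup V] [Module k V] {ρ : Representation k G V}
variable {H : Type uH} [AddCommGroup H] [Module k H] {τ : Representation k G H}
variable {ι : Type uι} {W : ι → Type uW} [∀ i, AddCommGroup (W i)] [∀ i, Module k (W i)]
variable {σ : ∀ i, Representation k G (W i)}

/-- The `i`-th component `π_i ∘ Φ ∘ f : ρ → σ i` of an intertwiner `f : ρ → τ`, read through an equivariant decomposition
`Φ : H ≃ ⨁ i, W i`, is an intertwiner (plumbing: existence of the bundled map with the displayed values). [folklore] -/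
private theorem exists_component (Φ : H ≃ₗ[k] ⨁ i, W i)
    (hΦ : ∀ (g : G) (x : H) (i : ι), Φ (τ g x) i = σ i g (Φ x i)) (f : ρ.IntertwiningMap τ) (i : ι) :
    ∃ c : ρ.IntertwiningMap (σ i), ∀ v, c v = Φ (f v) i :=
  ⟨LinearMap.intertwiningMap_of_isIntertwiningMap ρ (σ i)
      (DirectSum.component k ι W i ∘ₗ Φ.toLinearMap ∘ₗ f.toLinearMap) fun g v => by
        show DirectSum.component k ι W i (Φ (f (ρ g v))) = σ i g (DirectSum.component k ι W i (Φ (f v)))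
        rw [← DirectSum.apply_eq_component, ← DirectSum.apply_eq_component, f.isIntertwining, hΦ],
    fun _ => rfl⟩

/-- A component of an intertwiner out of an IRREDUCIBLE `ρ` into a summand that is irreducible or zero is zero or bijective
(kernels and images of intertwiners are subrepresentations). [folklore] -/
private theorem eq_zero_or_bijective [ρ.IsIrreducible] (hirr : ∀ i, Nontrivial (W i) → (σ i).IsIrreducible) {i : ι}
    (c : ρ.IntertwiningMap (σ i)) : c = 0 ∨ Function.Bijective c := by
  by_cases hW : Nontrivial (W i)
  · haveI := hirr i hW
    exact (Representation.IsIrreducible.bijective_or_eq_zero c).symm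
  · left
    haveI : Subsingleton (W i) := not_nontrivial_iff_subsingleton.mp hW
    exact Representation.IntertwiningMap.ext (LinearMap.ext fun v => Subsingleton.elim _ _)

/-- Two non-zero intertwiners out of an irreducible `ρ` into summands `σ i`, `σ j` that are irreducible or zero and pairwise
non-isomorphic force `i = j` (both are isomorphisms `ρ ≅ σ i`, `ρ ≅ σ j`). [folklore] -/
private theorem index_eq_of_ne_zero [ρ.IsIrreducible] (hirr : ∀ i, Nontrivial (W i) → (σ i).IsIrreducible)
    (hsep : ∀ i j, Nontrivial (W i) → Nonempty ((σ i).Equiv (σ j)) → i = j) {i j : ι}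
    {c : ρ.IntertwiningMap (σ i)} {c' : ρ.IntertwiningMap (σ j)} (hi : c ≠ 0) (hj : c' ≠ 0) : i = j := by
  haveI : Nontrivial V := Representation.IsIrreducible.nontrivial ρ
  have hbi := (eq_zero_or_bijective hirr c).resolve_left hi
  have hbj := (eq_zero_or_bijective hirr c').resolve_left hj
  exact hsep i j hbi.1.nontrivial ⟨(c.ofBijective hbi).symm.trans (c'.ofBijective hbj)⟩

/-- If every component of `Φ (f v)` off the index `i₀` vanishes then `f v = Φ⁻¹ (ι_{i₀} (Φ (f v) i₀))`. [folklore] -/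
private theorem apply_eq_symm_lof [DecidableEq ι] (Φ : H ≃ₗ[k] ⨁ i, W i) {f : ρ.IntertwiningMap τ} {i₀ : ι} {v : V}
    (h : ∀ j, j ≠ i₀ → Φ (f v) j = 0) : f v = Φ.symm (DirectSum.lof k ι W i₀ (Φ (f v) i₀)) := by
  rw [LinearEquiv.eq_symm_apply]
  refine DirectSum.ext_component k fun j => ?_
  rw [← DirectSum.apply_eq_component, ← DirectSum.apply_eq_component, DirectSum.lof_eq_of]
  by_cases hj : j = i₀
  · subst hj
    rw [DirectSum.of_eq_same]
  · rw [DirectSum.of_eq_of_ne _ _ _ hj, h j hj]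

variable [TopologicalSpace G] [SeparatelyContinuousMul G] [IsAlgClosed k]

/-- **Every intertwiner is a multiple of a given non-zero one.**  Let `τ ≅ ⨁ i, σ i` `G`-equivariantly, the `σ i`
irreducible or zero, admissible (smooth with finite-dimensional fixed vectors under compact open subgroups) and pairwise
non-isomorphic, `G` possessing a compact open subgroup, `k` algebraically closed, `ρ` irreducible.  If `g : ρ → τ` is a non-zero
intertwiner then every intertwiner `f : ρ → τ` is `c • g` for a scalar `c` — Schur's lemma ([Bump1997, Prop. 4.2.4]: an
intertwining operator of an irreducible admissible representation is a scalar) applied to the one summand `σ i₀` through which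
both factor. [cite: Bump1997, Proposition 4.2.4] -/
theorem exists_eq_smul_of_ne_zero [ρ.IsIrreducible] (Φ : H ≃ₗ[k] ⨁ i, W i)
    (hΦ : ∀ (g : G) (x : H) (i : ι), Φ (τ g x) i = σ i g (Φ x i))
    (hirr : ∀ i, Nontrivial (W i) → (σ i).IsIrreducible) (hadm : ∀ i, (σ i).IsAdmissible)
    (hsep : ∀ i j, Nontrivial (W i) → Nonempty ((σ i).Equiv (σ j)) → i = j)
    (hK : ∃ K : Subgroup G, IsOpen (K : Set G) ∧ IsCompact (K : Set G))
    {g : ρ.IntertwiningMap τ} (hg : g ≠ 0) (f : ρ.IntertwiningMap τ) : ∃ c : k, f = c • g := by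
  classical
  haveI : Nontrivial V := Representation.IsIrreducible.nontrivial ρ
  -- the components `cp f i : ρ → σ i`, `cp f i v = Φ (f v) i`
  choose cp hcp using exists_component (ρ := ρ) Φ hΦ
  -- `g ≠ 0` has a non-zero component `i₀`
  obtain ⟨i₀, hi₀⟩ : ∃ i₀, cp g i₀ ≠ 0 := by
    by_contra hall
    push Not at hall
    apply hg
    refine Representation.IntertwiningMap.ext (LinearMap.ext fun v => ?_)
    change g v = 0
    apply Φ.injective
    rw [map_zero]
    refine DirectSum.ext_component k fun j => ?_
    rw [← DirectSum.apply_eq_component, ← DirectSum.apply_eq_component, ← hcp g j v, hall j]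
    rfl
  -- every intertwiner has all its components off `i₀` equal to zero
  have hoff : ∀ (f : ρ.IntertwiningMap τ) (v : V) (j : ι), j ≠ i₀ → Φ (f v) j = 0 := by
    intro f v j hj
    by_cases hne : cp f j = 0
    · rw [← hcp f j v, hne]
      rfl
    · exact absurd (index_eq_of_ne_zero hirr hsep hne hi₀) hj
  -- the `i₀`-component of `g` is an isomorphism `e : ρ ≅ σ i₀`; Schur on `σ i₀` for `cp f i₀ ∘ e⁻¹`
  have hbij := (eq_zero_or_bijective hirr (cp g i₀)).resolve_left hi₀
  haveI := hirr i₀ hbij.1.nontrivial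
  obtain ⟨K, hKo, hKc⟩ := hK
  obtain ⟨c, hc⟩ := (hadm i₀).exists_eq_smul_id hKo hKc
    ((cp f i₀).toLinearMap ∘ₗ ((cp g i₀).ofBijective hbij).toLinearEquiv.symm.toLinearMap) fun x => by
      apply LinearMap.ext
      intro w
      simp only [LinearMap.coe_comp, Function.comp_apply, LinearEquiv.coe_coe,
        Representation.IntertwiningMap.coe_toLinearMap, Representation.Equiv.coe_symm]
      rw [← Representation.Equiv.coe_toIntertwiningMap,
        (((cp g i₀).ofBijective hbij).symm.toIntertwiningMap).isIntertwining _ _ x w, (cp f i₀).isIntertwining _ _ x]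
  -- hence `cp f i₀ = c • cp g i₀` pointwise, and `f = c • g`
  have hcomp : ∀ v, cp f i₀ v = c • cp g i₀ v := by
    intro v
    have := congr($hc (((cp g i₀).ofBijective hbij).toLinearEquiv v))
    simp only [LinearMap.coe_comp, Function.comp_apply, LinearEquiv.coe_coe, LinearEquiv.symm_apply_apply,
      Representation.IntertwiningMap.coe_toLinearMap, LinearMap.smul_apply, LinearMap.id_apply] at this
    rw [this]
    rfl
  refine ⟨c, Representation.IntertwiningMap.ext (LinearMap.ext fun v => ?_)⟩
  show f v = c • g v
  rw [apply_eq_symm_lof Φ (hoff f v), apply_eq_symm_lof Φ (hoff g v), ← hcp, ← hcp, hcomp, map_smul, map_smul]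

/-- **Multiplicity at most one, Hom-space form.**  Let `τ` be `G`-equivariantly isomorphic to a direct sum `⨁ i, σ i` of
representations that are irreducible or zero, admissible and pairwise non-isomorphic, over an algebraically closed field, for
a topological group `G` possessing a compact open subgroup.  Then for every irreducible `ρ` the space `Hom_G(ρ, τ)` of
intertwining maps has rank `≤ 1` (Schur's lemma for irreducible admissible representations, [Bump1997, Prop. 4.2.4], and
its direct-sum corollary — the shape of the multiplicity-one sentence of [Liu2021, Prop. 4.13, proof l. 2145]).
[cite: Bump1997, Proposition 4.2.4] -/
theorem rank_intertwiningMap_le_one_of_equivariant_directSum [ρ.IsIrreducible] (Φ : H ≃ₗ[k] ⨁ i, W i)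
    (hΦ : ∀ (g : G) (x : H) (i : ι), Φ (τ g x) i = σ i g (Φ x i))
    (hirr : ∀ i, Nontrivial (W i) → (σ i).IsIrreducible) (hadm : ∀ i, (σ i).IsAdmissible)
    (hsep : ∀ i j, Nontrivial (W i) → Nonempty ((σ i).Equiv (σ j)) → i = j)
    (hK : ∃ K : Subgroup G, IsOpen (K : Set G) ∧ IsCompact (K : Set G)) :
    Module.rank k (ρ.IntertwiningMap τ) ≤ 1 := by
  rw [rank_le_one_iff]
  by_cases h0 : ∀ g : ρ.IntertwiningMap τ, g = 0
  · exact ⟨0, fun f => ⟨0, by rw [h0 f, smul_zero]⟩⟩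
  · push Not at h0
    obtain ⟨g, hg⟩ := h0
    refine ⟨g, fun f => ?_⟩
    obtain ⟨c, hc⟩ := exists_eq_smul_of_ne_zero Φ hΦ hirr hadm hsep hK hg f
    exact ⟨c, hc.symm⟩

/-- **Multiplicity exactly one at a non-zero summand.**  Under the same hypotheses a non-zero summand `σ i₀` embeds into `τ`
(through `Φ⁻¹ ∘ ι_{i₀}`), so `Hom_G(σ i₀, τ)` is non-zero and has rank exactly `1`. [cite: Bump1997, Proposition 4.2.4] -/
theorem rank_intertwiningMap_eq_one_of_equivariant_directSum (Φ : H ≃ₗ[k] ⨁ i, W i)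
    (hΦ : ∀ (g : G) (x : H) (i : ι), Φ (τ g x) i = σ i g (Φ x i))
    (hirr : ∀ i, Nontrivial (W i) → (σ i).IsIrreducible) (hadm : ∀ i, (σ i).IsAdmissible)
    (hsep : ∀ i j, Nontrivial (W i) → Nonempty ((σ i).Equiv (σ j)) → i = j)
    (hK : ∃ K : Subgroup G, IsOpen (K : Set G) ∧ IsCompact (K : Set G)) (i₀ : ι) [Nontrivial (W i₀)] :
    Module.rank k ((σ i₀).IntertwiningMap τ) = 1 := by
  classical
  haveI := hirr i₀ inferInstance
  refine le_antisymm (rank_intertwiningMap_le_one_of_equivariant_directSum Φ hΦ hirr hadm hsep hK) ?_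
  -- the embedding `Φ⁻¹ ∘ lof i₀` is a non-zero intertwiner
  let j : (σ i₀).IntertwiningMap τ :=
    LinearMap.intertwiningMap_of_isIntertwiningMap (σ i₀) τ (Φ.symm.toLinearMap ∘ₗ DirectSum.lof k ι W i₀)
      fun g w => by
        simp only [LinearMap.coe_comp, LinearEquiv.coe_coe, Function.comp_apply]
        apply Φ.injective
        refine DirectSum.ext_component k fun j => ?_
        rw [← DirectSum.apply_eq_component, ← DirectSum.apply_eq_component, LinearEquiv.apply_symm_apply, hΦ,
          LinearEquiv.apply_symm_apply]
        simp only [DirectSum.lof_eq_of]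
        by_cases hj : j = i₀
        · subst hj
          rw [DirectSum.of_eq_same, DirectSum.of_eq_same]
        · rw [DirectSum.of_eq_of_ne _ _ _ hj, DirectSum.of_eq_of_ne _ _ _ hj, map_zero]
  have hj : j ≠ 0 := by
    intro h
    obtain ⟨w, hw⟩ := exists_ne (0 : W i₀)
    have : j w = 0 := by rw [h]; rfl
    apply hw
    have h2 : Φ.symm (DirectSum.lof k ι W i₀ w) = 0 := this
    rw [LinearEquiv.map_eq_zero_iff] at h2
    simpa using congr($h2 i₀)
  haveI : Nontrivial ((σ i₀).IntertwiningMap τ) := ⟨⟨j, 0, hj⟩⟩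
  exact Cardinal.one_le_iff_pos.mpr (rank_pos (R := k) (M := (σ i₀).IntertwiningMap τ))

end AdmissibleDirectSum

end Literature.RepresentationTheory

end
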